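import Summits.Ventures.YMGap.Thresholds.OneLinkRemainderPrime
import HarnessLib

/-!
# Venture YMGap — the one-link modulus beyond first order, part 58a: the RECENTRED cubic remainder, I — calculus of the shifted linear
# statistic and the shifted term lemmas (second foundation file of the mean-field recentring lever,
# cell notes `HOME/p2/ONE-LINK-HIERARCHY.md` §16 (α), `HOME/p2/hier/LEAN-SPEC-RECENTRING.md` F2)

HONEST FRAMING: venture file of the cell `pub-ymgap` (QuantumFields programme), strong-coupling LATTICE bookkeeping for `SU(N)`
lattice Yang–Mills; nothing about the continuum or the mass gap in the Clay sense.  Pure matrix calculus, no measure, no number of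
record.  WHAT.  The tree's non-linear cubic remainder `c₃′` (`OneLinkRemainderPrime`) carries the linear statistics `z_B = tr(gB)`,
`z_Δ = tr(gΔ)` in its `η`-slots (`η(z) = κ_t z − conj z/(4N)`) and in the weight factor `Im z_B`.  RECENTRING replaces them by the
fluctuations `z_B − m₁`, `z_Δ − m₂` for arbitrary complex constants `m₁, m₂` (in the application the means under `ν_B`; the mean part is
absorbed by `OneLinkRecentredPoisson.Lap_deltaPsi`).  This file is the tree's gradient calculus with that shift:
* `contDiff_reTrMul_sub`, `contDiff_imTrMul_sub`, `matD_reTrMul_sub`, `matD_imTrMul_sub`, `contDiff_quad_etaShift`,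
  `contDiff_imShift_mul_imProd`: calculus of the shifted linear statistic (the shift is invisible to `D_A`);
* `abs_matD_quad_etaShift_le`, `abs_matD_imShift_mul_imQuad_le`, `abs_matD_imShift_mul_imProd_le`: the tree's term lemmas
  (`OneLinkRemainderWords`) with `‖tr(gM)‖ ↦ ‖tr(gM) − m‖`, `|Im tr(gB)| ↦ |Im(tr(gB) − m)|` in the bound;
* (next file `OneLinkRecentredRemainder`: `abs_matD_c3hat_le`, `Gam_c3hat_le` — the assembled gradient bound of `ĉ₃′`).
References: cell notes above.
-/

noncomputable section

open scoped Matrix ComplexConjugate BigOperators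
open Matrix Complex Finset
open Literature.MathematicalPhysics.QuantumFieldTheory
open Literature.MathematicalPhysics.QuantumFieldTheory.SUNBakryEmery

namespace Summit.Ventures.YMGap.OneLinkEigen

variable {N : ℕ}

section Calc

open scoped Matrix.Norms.Frobenius ContDiff Topology

/-! ### The shifted linear statistic -/

/-- `Q ↦ Re(tr(QM) − m)` is smooth. [folklore] -/
theorem contDiff_reTrMul_sub (M : Matrix (Fin N) (Fin N) ℂ) (m : ℂ) :
    ContDiff ℝ ∞ fun Q : Matrix (Fin N) (Fin N) ℂ => ((Q * M).trace - m).re := by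
  have e : (fun Q : Matrix (Fin N) (Fin N) ℂ => ((Q * M).trace - m).re) = fun Q => (Q * M).trace.re - m.re := by
    funext Q; rw [sub_re]
  rw [e]; exact (contDiff_reTrMul M).sub contDiff_const

/-- `Q ↦ Im(tr(QM) − m)` is smooth. [folklore] -/
theorem contDiff_imTrMul_sub (M : Matrix (Fin N) (Fin N) ℂ) (m : ℂ) :
    ContDiff ℝ ∞ fun Q : Matrix (Fin N) (Fin N) ℂ => ((Q * M).trace - m).im := by
  have e : (fun Q : Matrix (Fin N) (Fin N) ℂ => ((Q * M).trace - m).im) = fun Q => (Q * M).trace.im - m.im := by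
    funext Q; rw [sub_im]
  rw [e]; exact (contDiff_imTrMul M).sub contDiff_const

/-- `D_A Re(tr(QM) − m) = Re tr(QAM)` (the shift is invisible to the derivative). [folklore] -/
theorem matD_reTrMul_sub (A M : Matrix (Fin N) (Fin N) ℂ) (m : ℂ) :
    matD A (fun Q : Matrix (Fin N) (Fin N) ℂ => ((Q * M).trace - m).re) = fun Q => (Q * A * M).trace.re := by
  have e : (fun Q : Matrix (Fin N) (Fin N) ℂ => ((Q * M).trace - m).re) =
      (fun Q : Matrix (Fin N) (Fin N) ℂ => (Q * M).trace.re) - fun _ => m.re := by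
    funext Q; simp only [Pi.sub_apply, sub_re]
  rw [e, matD_sub (contDiff_reTrMul M) contDiff_const, matD_reTrMul, matD_const]
  funext Q; simp

/-- `D_A Im(tr(QM) − m) = Im tr(QAM)`. [folklore] -/
theorem matD_imTrMul_sub (A M : Matrix (Fin N) (Fin N) ℂ) (m : ℂ) :
    matD A (fun Q : Matrix (Fin N) (Fin N) ℂ => ((Q * M).trace - m).im) = fun Q => (Q * A * M).trace.im := by
  have e : (fun Q : Matrix (Fin N) (Fin N) ℂ => ((Q * M).trace - m).im) =
      (fun Q : Matrix (Fin N) (Fin N) ℂ => (Q * M).trace.im) - fun _ => m.im := by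
    funext Q; simp only [Pi.sub_apply, sub_im]
  rw [e, matD_sub (contDiff_imTrMul M) contDiff_const, matD_imTrMul, matD_const]
  funext Q; simp

/-- The shifted complex-`η` product `Q ↦ Re[tr(QM₁QM₂)·(κ(tr(QM) − m) − c conj(tr(QM) − m))]` is smooth. [folklore] -/
theorem contDiff_quad_etaShift (κ c : ℝ) (M₁ M₂ M : Matrix (Fin N) (Fin N) ℂ) (m : ℂ) :
    ContDiff ℝ ∞ fun Q : Matrix (Fin N) (Fin N) ℂ =>
      ((Q * M₁ * Q * M₂).trace * ((κ : ℂ) * ((Q * M).trace - m) - (c : ℂ) * (starRingEnd ℂ) ((Q * M).trace - m))).re := by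
  have hF : (fun Q : Matrix (Fin N) (Fin N) ℂ =>
        ((Q * M₁ * Q * M₂).trace * ((κ : ℂ) * ((Q * M).trace - m) - (c : ℂ) * (starRingEnd ℂ) ((Q * M).trace - m))).re) =
      fun Q => (κ - c) * ((Q * M₁ * Q * M₂).trace.re * ((Q * M).trace - m).re)
        + (-(κ + c)) * ((Q * M₁ * Q * M₂).trace.im * ((Q * M).trace - m).im) := by
    funext Q
    simp only [mul_re, sub_re, sub_im, mul_im, conj_re, conj_im, ofReal_re, ofReal_im]
    ring
  rw [hF]
  exact (contDiff_const.mul ((contDiff_reTrQuad M₁ M₂).mul (contDiff_reTrMul_sub M m))).add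
    (contDiff_const.mul ((contDiff_imTrQuad M₁ M₂).mul (contDiff_imTrMul_sub M m)))

/-- The shifted triple product `Q ↦ Im(tr(QB) − m)·Im(tr(QB)tr(QΔ))` is smooth. [folklore] -/
theorem contDiff_imShift_mul_imProd (B Δ : Matrix (Fin N) (Fin N) ℂ) (m : ℂ) :
    ContDiff ℝ ∞ fun Q : Matrix (Fin N) (Fin N) ℂ => ((Q * B).trace - m).im * ((Q * B).trace * (Q * Δ).trace).im := by
  have hF : (fun Q : Matrix (Fin N) (Fin N) ℂ => ((Q * B).trace - m).im * ((Q * B).trace * (Q * Δ).trace).im) =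
      fun Q => ((Q * B).trace - m).im * ((Q * B).trace.re * (Q * Δ).trace.im + (Q * B).trace.im * (Q * Δ).trace.re) := by
    funext Q; simp only [mul_im]
  rw [hF]
  exact (contDiff_imTrMul_sub B m).mul (((contDiff_reTrMul B).mul (contDiff_imTrMul Δ)).add
    ((contDiff_imTrMul B).mul (contDiff_reTrMul Δ)))

/-! ### The shifted term lemmas -/

/-- (Recentred form of `OneLinkRemainderWords.abs_matD_quad_eta_le`.) **Complex product rule for `Re[tr(QM₁QM₂)·(κ tr(QM) − c conj tr(QM))]`** on `SU(N)` (`κ, c ≥ 0`):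
`|D_A(…)(g)| ≤ (κ + c)((‖M₁gM₂‖_F + ‖M₂gM₁‖_F)‖tr(gM)‖ + ‖tr(gM₁gM₂)‖‖M‖_F)‖A‖_F`. [folklore] -/
theorem abs_matD_quad_etaShift_le {κ c : ℝ} (hκ : 0 ≤ κ) (hc : 0 ≤ c) (A M₁ M₂ M : Matrix (Fin N) (Fin N) ℂ) (m : ℂ)
    (g : SUN N) :
    |matD A (fun Q : Matrix (Fin N) (Fin N) ℂ =>
        ((Q * M₁ * Q * M₂).trace * ((κ : ℂ) * ((Q * M).trace - m) - (c : ℂ) * (starRingEnd ℂ) ((Q * M).trace - m))).re) g| ≤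
      (κ + c) * ((frobNorm (M₁ * (g : Matrix (Fin N) (Fin N) ℂ) * M₂) + frobNorm (M₂ * (g : Matrix (Fin N) (Fin N) ℂ) * M₁)) *
          ‖((g : Matrix (Fin N) (Fin N) ℂ) * M).trace - m‖
        + ‖((g : Matrix (Fin N) (Fin N) ℂ) * M₁ * g * M₂).trace‖ * frobNorm M) * frobNorm A := by
  set Q : Matrix (Fin N) (Fin N) ℂ := (g : Matrix (Fin N) (Fin N) ℂ) with hQ
  -- real form of the function
  have hF : (fun Q : Matrix (Fin N) (Fin N) ℂ =>
        ((Q * M₁ * Q * M₂).trace * ((κ : ℂ) * ((Q * M).trace - m) - (c : ℂ) * (starRingEnd ℂ) ((Q * M).trace - m))).re) =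
      fun Q => (κ - c) * ((Q * M₁ * Q * M₂).trace.re * ((Q * M).trace - m).re)
        + (-(κ + c)) * ((Q * M₁ * Q * M₂).trace.im * ((Q * M).trace - m).im) := by
    funext Q
    simp only [mul_re, sub_re, sub_im, mul_im, conj_re, conj_im, ofReal_re, ofReal_im]
    ring
  have hwr := contDiff_reTrQuad (N := N) M₁ M₂
  have hwi := contDiff_imTrQuad (N := N) M₁ M₂
  have hzr := contDiff_reTrMul_sub (N := N) M m
  have hzi := contDiff_imTrMul_sub (N := N) M m
  have hp1 : ContDiff ℝ ∞ fun Q : Matrix (Fin N) (Fin N) ℂ => (Q * M₁ * Q * M₂).trace.re * ((Q * M).trace - m).re :=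
    hwr.mul hzr
  have hp2 : ContDiff ℝ ∞ fun Q : Matrix (Fin N) (Fin N) ℂ => (Q * M₁ * Q * M₂).trace.im * ((Q * M).trace - m).im :=
    hwi.mul hzi
  have h1 : ContDiff ℝ ∞ fun Q : Matrix (Fin N) (Fin N) ℂ => (κ - c) * ((Q * M₁ * Q * M₂).trace.re * ((Q * M).trace - m).re) :=
    contDiff_const.mul hp1
  have h2 : ContDiff ℝ ∞ fun Q : Matrix (Fin N) (Fin N) ℂ =>
      (-(κ + c)) * ((Q * M₁ * Q * M₂).trace.im * ((Q * M).trace - m).im) :=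
    contDiff_const.mul hp2
  rw [hF, matD_fun_add h1 h2, matD_const_mul hp1, matD_const_mul hp2, matD_fun_mul hwr hzr, matD_fun_mul hwi hzi,
    matD_reTrQuad, matD_imTrQuad, matD_reTrMul_sub, matD_imTrMul_sub]
  simp only []
  -- the complex bookkeeping
  set W : ℂ := (Q * M₁ * Q * M₂).trace with hW
  set dW : ℂ := (Q * A * M₁ * Q * M₂).trace + (Q * M₁ * Q * A * M₂).trace with hdW
  set z : ℂ := (Q * M).trace - m with hz
  set dz : ℂ := (Q * A * M).trace with hdz
  have e : (κ - c) * (W.re * dz.re + z.re * ((Q * A * M₁ * Q * M₂).trace.re + (Q * M₁ * Q * A * M₂).trace.re))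
        + (-(κ + c)) * (W.im * dz.im + z.im * ((Q * A * M₁ * Q * M₂).trace.im + (Q * M₁ * Q * A * M₂).trace.im)) =
      (dW * ((κ : ℂ) * z - (c : ℂ) * (starRingEnd ℂ) z)).re + (W * ((κ : ℂ) * dz - (c : ℂ) * (starRingEnd ℂ) dz)).re := by
    simp only [hdW, mul_re, add_re, add_im, sub_re, sub_im, mul_im, conj_re, conj_im, ofReal_re, ofReal_im]
    ring
  rw [e]
  have hA := frobNorm_nonneg A
  have hκc : 0 ≤ κ + c := add_nonneg hκ hc
  have b1 : ‖dW‖ ≤ (frobNorm (M₁ * Q * M₂) + frobNorm (M₂ * Q * M₁)) * frobNorm A := norm_dQuad_le A M₁ M₂ g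
  have b2 : ‖(κ : ℂ) * z - (c : ℂ) * (starRingEnd ℂ) z‖ ≤ (κ + c) * ‖z‖ := norm_kappa_sub_conj_le hκ hc z
  have b3 : ‖(κ : ℂ) * dz - (c : ℂ) * (starRingEnd ℂ) dz‖ ≤ (κ + c) * (frobNorm A * frobNorm M) :=
    (norm_kappa_sub_conj_le hκ hc dz).trans (mul_le_mul_of_nonneg_left (norm_trace_su_mul_mul_le g A M) hκc)
  calc _ ≤ |(dW * ((κ : ℂ) * z - (c : ℂ) * (starRingEnd ℂ) z)).re| + |(W * ((κ : ℂ) * dz - (c : ℂ) * (starRingEnd ℂ) dz)).re| :=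
        abs_add_le _ _
    _ ≤ ‖dW‖ * ‖(κ : ℂ) * z - (c : ℂ) * (starRingEnd ℂ) z‖ + ‖W‖ * ‖(κ : ℂ) * dz - (c : ℂ) * (starRingEnd ℂ) dz‖ :=
        add_le_add (abs_re_mul_le_norm_mul_norm _ _) (abs_re_mul_le_norm_mul_norm _ _)
    _ ≤ ((frobNorm (M₁ * Q * M₂) + frobNorm (M₂ * Q * M₁)) * frobNorm A) * ((κ + c) * ‖z‖)
          + ‖W‖ * ((κ + c) * (frobNorm A * frobNorm M)) :=
        add_le_add (mul_le_mul b1 b2 (norm_nonneg _) (mul_nonneg (add_nonneg (frobNorm_nonneg _) (frobNorm_nonneg _)) hA))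
          (mul_le_mul_of_nonneg_left b3 (norm_nonneg _))
    _ = _ := by ring

/-- **`|D_A [Im(tr(QB) − m) · Im tr(QΔQB)](g)| ≤ (2‖B‖_op‖Δ‖_F |Im(tr(gB) − m)| + ‖B‖_F ‖tr(gΔgB)‖) ‖A‖_F`** on `SU(N)`
(recentred weight statistic). [folklore] -/
theorem abs_matD_imShift_mul_imQuad_le (A B Δ : Matrix (Fin N) (Fin N) ℂ) (m : ℂ) (g : SUN N) :
    |matD A (fun Q : Matrix (Fin N) (Fin N) ℂ => ((Q * B).trace - m).im * (Q * Δ * Q * B).trace.im) g| ≤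
      (2 * matrixOpNorm B * frobNorm Δ * |(((g : Matrix (Fin N) (Fin N) ℂ) * B).trace - m).im|
        + frobNorm B * ‖((g : Matrix (Fin N) (Fin N) ℂ) * Δ * g * B).trace‖) * frobNorm A := by
  set Q : Matrix (Fin N) (Fin N) ℂ := (g : Matrix (Fin N) (Fin N) ℂ) with hQ
  have hX := contDiff_imTrMul_sub (N := N) B m
  have hw := contDiff_imTrQuad (N := N) Δ B
  rw [matD_fun_mul hX hw, matD_imTrMul_sub, matD_imTrQuad]
  simp only []
  set dW : ℂ := (Q * A * Δ * Q * B).trace + (Q * Δ * Q * A * B).trace with hdW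
  have e : (Q * A * Δ * Q * B).trace.im + (Q * Δ * Q * A * B).trace.im = dW.im := by rw [hdW, add_im]
  rw [e]
  have hA := frobNorm_nonneg A
  have b1 : ‖dW‖ ≤ 2 * matrixOpNorm B * frobNorm Δ * frobNorm A := by
    refine (norm_dQuad_le A Δ B g).trans ?_
    have h1 := frobNorm_MgB_le Δ B g
    have h2 := frobNorm_BgM_le B Δ g
    nlinarith
  have b2 : |dW.im| ≤ ‖dW‖ := abs_im_le_norm' dW
  have b3 : |(Q * A * B).trace.im| ≤ frobNorm A * frobNorm B := (abs_im_le_norm' _).trans (norm_trace_su_mul_mul_le g A B)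
  have b4 : |(Q * Δ * Q * B).trace.im| ≤ ‖(Q * Δ * Q * B).trace‖ := abs_im_le_norm' _
  calc |((Q * B).trace - m).im * dW.im + (Q * Δ * Q * B).trace.im * (Q * A * B).trace.im|
      ≤ |((Q * B).trace - m).im| * |dW.im| + |(Q * Δ * Q * B).trace.im| * |(Q * A * B).trace.im| := by
        refine (abs_add_le _ _).trans ?_; rw [abs_mul, abs_mul]
    _ ≤ |((Q * B).trace - m).im| * (2 * matrixOpNorm B * frobNorm Δ * frobNorm A)
          + ‖(Q * Δ * Q * B).trace‖ * (frobNorm A * frobNorm B) :=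
        add_le_add (mul_le_mul_of_nonneg_left (b2.trans b1) (abs_nonneg _))
          (mul_le_mul b4 b3 (abs_nonneg _) (norm_nonneg _))
    _ = _ := by ring

/-- **`|D_A [Im(tr(QB) − m) · Im(tr(QB) tr(QΔ))](g)| ≤ (|Im(tr(gB) − m)|(‖B‖_F‖tr(gΔ)‖ + ‖Δ‖_F‖tr(gB)‖) + ‖B‖_F‖tr(gB)‖‖tr(gΔ)‖) ‖A‖_F`**
on `SU(N)` (recentred weight statistic in the outer factor only). [folklore] -/
theorem abs_matD_imShift_mul_imProd_le (A B Δ : Matrix (Fin N) (Fin N) ℂ) (m : ℂ) (g : SUN N) :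
    |matD A (fun Q : Matrix (Fin N) (Fin N) ℂ => ((Q * B).trace - m).im * ((Q * B).trace * (Q * Δ).trace).im) g| ≤
      (|(((g : Matrix (Fin N) (Fin N) ℂ) * B).trace - m).im| *
          (frobNorm B * ‖((g : Matrix (Fin N) (Fin N) ℂ) * Δ).trace‖ + frobNorm Δ * ‖((g : Matrix (Fin N) (Fin N) ℂ) * B).trace‖)
        + frobNorm B * ‖((g : Matrix (Fin N) (Fin N) ℂ) * B).trace‖ * ‖((g : Matrix (Fin N) (Fin N) ℂ) * Δ).trace‖) * frobNorm A := by
  set Q : Matrix (Fin N) (Fin N) ℂ := (g : Matrix (Fin N) (Fin N) ℂ) with hQ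
  have hF : (fun Q : Matrix (Fin N) (Fin N) ℂ => ((Q * B).trace - m).im * ((Q * B).trace * (Q * Δ).trace).im) =
      fun Q => ((Q * B).trace - m).im * ((Q * B).trace.re * (Q * Δ).trace.im + (Q * B).trace.im * (Q * Δ).trace.re) := by
    funext Q; simp only [mul_im]
  have hBr := contDiff_reTrMul (N := N) B
  have hBi := contDiff_imTrMul (N := N) B
  have hBs := contDiff_imTrMul_sub (N := N) B m
  have hΔr := contDiff_reTrMul (N := N) Δ
  have hΔi := contDiff_imTrMul (N := N) Δ
  have hq1 : ContDiff ℝ ∞ fun Q : Matrix (Fin N) (Fin N) ℂ => (Q * B).trace.re * (Q * Δ).trace.im := hBr.mul hΔi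
  have hq2 : ContDiff ℝ ∞ fun Q : Matrix (Fin N) (Fin N) ℂ => (Q * B).trace.im * (Q * Δ).trace.re := hBi.mul hΔr
  have hin : ContDiff ℝ ∞ fun Q : Matrix (Fin N) (Fin N) ℂ =>
      (Q * B).trace.re * (Q * Δ).trace.im + (Q * B).trace.im * (Q * Δ).trace.re := hq1.add hq2
  rw [hF, matD_fun_mul hBs hin, matD_fun_add hq1 hq2, matD_fun_mul hBr hΔi, matD_fun_mul hBi hΔr, matD_reTrMul,
    matD_imTrMul, matD_imTrMul, matD_reTrMul, matD_imTrMul_sub]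
  simp only []
  set z₁ : ℂ := (Q * B).trace with hz₁
  set z₂ : ℂ := (Q * Δ).trace with hz₂
  set d₁ : ℂ := (Q * A * B).trace with hd₁
  set d₂ : ℂ := (Q * A * Δ).trace with hd₂
  have e1 : z₁.re * d₂.im + z₂.im * d₁.re + (z₁.im * d₂.re + z₂.re * d₁.im) = (d₁ * z₂).im + (z₁ * d₂).im := by
    simp only [mul_im]; ring
  have e2 : z₁.re * z₂.im + z₁.im * z₂.re = (z₁ * z₂).im := by rw [mul_im]
  rw [e1, e2]
  have hA := frobNorm_nonneg A
  have b1 : |(d₁ * z₂).im + (z₁ * d₂).im| ≤ frobNorm A * frobNorm B * ‖z₂‖ + ‖z₁‖ * (frobNorm A * frobNorm Δ) := by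
    refine (abs_add_le _ _).trans (add_le_add ?_ ?_)
    · refine (abs_im_le_norm' _).trans ?_
      rw [norm_mul]
      exact mul_le_mul_of_nonneg_right (norm_trace_su_mul_mul_le g A B) (norm_nonneg _)
    · refine (abs_im_le_norm' _).trans ?_
      rw [norm_mul]
      exact mul_le_mul_of_nonneg_left (norm_trace_su_mul_mul_le g A Δ) (norm_nonneg _)
  have b2 : |(z₁ * z₂).im| ≤ ‖z₁‖ * ‖z₂‖ := (abs_im_le_norm' _).trans (norm_mul_le _ _)
  have b3 : |d₁.im| ≤ frobNorm A * frobNorm B := (abs_im_le_norm' _).trans (norm_trace_su_mul_mul_le g A B)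
  calc |(z₁ - m).im * ((d₁ * z₂).im + (z₁ * d₂).im) + (z₁ * z₂).im * d₁.im|
      ≤ |(z₁ - m).im| * |(d₁ * z₂).im + (z₁ * d₂).im| + |(z₁ * z₂).im| * |d₁.im| := by
        refine (abs_add_le _ _).trans ?_; rw [abs_mul, abs_mul]
    _ ≤ |(z₁ - m).im| * (frobNorm A * frobNorm B * ‖z₂‖ + ‖z₁‖ * (frobNorm A * frobNorm Δ))
          + ‖z₁‖ * ‖z₂‖ * (frobNorm A * frobNorm B) :=
        add_le_add (mul_le_mul_of_nonneg_left b1 (abs_nonneg _)) (mul_le_mul b2 b3 (abs_nonneg _) (by positivity))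
    _ = _ := by ring


end Calc

end Summit.Ventures.YMGap.OneLinkEigen
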